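import Summits.CriticalPhenomena.PercolationContinuityZ3.Theorems.PercNonProliferationFreeBoxSparseDenseMarkov
import Summits.CriticalPhenomena.PercolationContinuityZ3.Theorems.PercTorusSliceFillingThinClusterTransport
import HarnessLib

/-!
# Crux `PercNonProliferation.FreeBoxSparse` (stmt-CriticalPhenomena-4445) — the torus parking edge

`PercTorusSliceFilling.NoCriticalTorusGiant → PercNonProliferation.FreeBoxSparse`: if the critical
3-torus `(ℤ/nℤ)³` carries no giant open cluster (item stmt-CriticalPhenomena-5407, T-B of the torus
route), then the free-box pair average `FA₂(p_c, m)` tends to `0` (this crux, r3 of the route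
`PercNonProliferation`). The proof is the two-line monotonicity "box ⊆ torus" recorded in
`Cruxes/FreeBoxSparse/STRATEGY-CENSUS.md` §S6, kernel-checked:

* `pairSum_le_of_dense` (pointwise bookkeeping, every `p`, every finite `Λ`):
  `Σ_{x,y∈Λ} P_p(x ↔ y inside Λ) ≤ δ|Λ|² + |Λ|²·P_p(Λ has a δ-dense free piece)` — off the dense
  event every free piece has fewer than `δ|Λ|` points, on it at most `|Λ|`.
* `real_dense_le_torusGiant` (the chart, every `p`): for `2m + 2 ≤ n` and `s ≤ δ|B(m)|`,
  `P_p^{ℤ³}(B(m) has a δ-dense free piece) ≤ P_p^{T_n}(some open cluster has ≥ s vertices)` — the box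
  `B(m)` embeds into `T_n` by the local chart of `PercTorusSliceFillingThinClusterTransport`
  (`integral_restrictConfig_chart_eq`: the torus configuration pulled back along the chart has the law
  of the box-restricted `ℤ³` configuration), and a free piece of the box maps injectively into the
  torus cluster of its image (`ncard_reachable_restrictConfig_le`).
* `freeBoxSparse_of_noCriticalTorusGiant`: with `n = 2m + 2`, `|B(m)| = (2m+1)³ ≥ n³/8`, so
  `FA₂(p_c, m) ≤ δ + P_{T_{2m+2}}(∃ cluster ≥ (δ/8) n³) → δ`; `δ ↓ 0`.

* `freeBoxSparse_iff_noFreeGiant` (appended): `FreeBoxSparse ⟺ ∀ δ > 0, P_{p_c}(B(n) has a δ-dense free piece) → 0`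
  (`pairSum_le_of_dense` + `DenseMarkov.real_exists_dense_le_pairAverage_div`).

So the crux is implied by each of: `θ(p_c) = 0` (`Negative/OfContinuity`), X_B
(`Parking.freeBoxSparse_of_critAnnulusNonCrossing`), r5 (`Parking.freeBoxSparse_of_freeBoxPowerSaving`),
γ < 2 (`freeBoxSparse_of_susceptibilitySubquadratic`), and T-B (this file).
-/

noncomputable section

namespace Summit.CriticalPhenomena.PercolationContinuityZ3.Theorems.FreeBoxSparse.TorusParking

open MeasureTheory Filter Set
open scoped Topology Classical
open Literature.Probability.Percolation Literature.Probability.LatticeModels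
open Summit.CriticalPhenomena.PercolationContinuityZ3.Theses.PercNonProliferation (FreeBoxSparse)
open Summit.CriticalPhenomena.PercolationContinuityZ3.Theses.PercTorusSliceFilling (NoCriticalTorusGiant)
open Summit.CriticalPhenomena.PercolationContinuityZ3.Theorems.PercTorusSliceFillingThinClusterTransport

/-- **Pair sum versus dense pieces** (every `p`, every finite `Λ ⊂ ℤ³`, `δ ≥ 0`):
`Σ_{x,y∈Λ} P_p(x ↔ y inside Λ) ≤ δ|Λ|² + |Λ|²·P_p(∃ x ∈ Λ, |C_Λ(x)| ≥ δ|Λ|)`. Pointwise the pair count is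
`Σ_x |C_Λ(x)|`; off the dense event every term is `< δ|Λ|`, and always every term is `≤ |Λ|`. [folklore] -/
theorem pairSum_le_of_dense (p : unitInterval) (Λ : Finset (Site 3)) {δ : ℝ} (hδ : 0 ≤ δ) :
    ∑ x ∈ Λ, ∑ y ∈ Λ, (bondPercolation (zdGraph 3) p).real (openConnIn (↑Λ : Set (Site 3)) x y) ≤
      δ * (Λ.card : ℝ) ^ 2 + (Λ.card : ℝ) ^ 2 *
        (bondPercolation (zdGraph 3) p).real {ω | ∃ x ∈ Λ,
          δ * (Λ.card : ℝ) ≤ (((Λ.filter fun v => ω ∈ openConnIn (↑Λ : Set (Site 3)) x v)).card : ℝ)} := by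
  set μ := bondPercolation (zdGraph 3) p with hμ
  set D := {ω : BondConfig (Site 3) | ∃ x ∈ Λ,
      δ * (Λ.card : ℝ) ≤ (((Λ.filter fun v => ω ∈ openConnIn (↑Λ : Set (Site 3)) x v)).card : ℝ)} with hD
  have hDm : MeasurableSet D := measurableSet_exists_dense Λ δ
  have hAm : ∀ x y : Site 3, MeasurableSet (openConnIn (↑Λ : Set (Site 3)) x y) :=
    fun x y => DCT16.measurableSet_openConnIn Λ x y
  set g : BondConfig (Site 3) → ℝ := fun ω =>
      ∑ x ∈ Λ, ∑ y ∈ Λ, (openConnIn (↑Λ : Set (Site 3)) x y).indicator (1 : BondConfig (Site 3) → ℝ) ω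
    with hg
  have hint : ∀ x y : Site 3, Integrable
      (fun ω => (openConnIn (↑Λ : Set (Site 3)) x y).indicator (1 : BondConfig (Site 3) → ℝ) ω) μ :=
    fun x y => (integrable_const (1 : ℝ)).indicator (hAm x y)
  have hgint : Integrable g μ :=
    integrable_finsetSum _ fun x _ => integrable_finsetSum _ fun y _ => hint x y
  -- piece sizes as sums of indicators
  have hpiece : ∀ (ω : BondConfig (Site 3)) (x : Site 3),
      (∑ y ∈ Λ, (openConnIn (↑Λ : Set (Site 3)) x y).indicator (1 : BondConfig (Site 3) → ℝ) ω) =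
        (((Λ.filter fun v => ω ∈ openConnIn (↑Λ : Set (Site 3)) x v)).card : ℝ) := by
    intro ω x
    rw [Finset.natCast_card_filter]
    refine Finset.sum_congr rfl fun y _ => ?_
    by_cases h : ω ∈ openConnIn (↑Λ : Set (Site 3)) x y <;> simp [h]
  -- the pointwise bound
  have hpt : ∀ ω, g ω ≤ δ * (Λ.card : ℝ) ^ 2 + (Λ.card : ℝ) ^ 2 * D.indicator (1 : BondConfig (Site 3) → ℝ) ω := by
    intro ω
    by_cases hω : ω ∈ D
    · have h1 : ∀ x ∈ Λ, (∑ y ∈ Λ, (openConnIn (↑Λ : Set (Site 3)) x y).indicator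
          (1 : BondConfig (Site 3) → ℝ) ω) ≤ (Λ.card : ℝ) := by
        intro x _
        rw [hpiece]
        exact_mod_cast Finset.card_filter_le _ _
      have h2 : 0 ≤ δ * (Λ.card : ℝ) ^ 2 := by positivity
      calc g ω ≤ ∑ _x ∈ Λ, (Λ.card : ℝ) := Finset.sum_le_sum h1
        _ = (Λ.card : ℝ) ^ 2 := by rw [Finset.sum_const, nsmul_eq_mul, sq]
        _ ≤ δ * (Λ.card : ℝ) ^ 2 + (Λ.card : ℝ) ^ 2 * D.indicator (1 : BondConfig (Site 3) → ℝ) ω := by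
          rw [Set.indicator_of_mem hω, Pi.one_apply, mul_one]
          linarith
    · have h1 : ∀ x ∈ Λ, (∑ y ∈ Λ, (openConnIn (↑Λ : Set (Site 3)) x y).indicator
          (1 : BondConfig (Site 3) → ℝ) ω) ≤ δ * (Λ.card : ℝ) := by
        intro x hx
        rw [hpiece]
        by_contra hlt
        exact hω ⟨x, hx, (not_le.1 hlt).le⟩
      calc g ω ≤ ∑ _x ∈ Λ, δ * (Λ.card : ℝ) := Finset.sum_le_sum h1
        _ = δ * (Λ.card : ℝ) ^ 2 := by rw [Finset.sum_const, nsmul_eq_mul]; ring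
        _ ≤ δ * (Λ.card : ℝ) ^ 2 + (Λ.card : ℝ) ^ 2 * D.indicator (1 : BondConfig (Site 3) → ℝ) ω := by
          rw [Set.indicator_of_notMem hω, mul_zero, add_zero]
  -- integrate
  have hlhs : ∑ x ∈ Λ, ∑ y ∈ Λ, μ.real (openConnIn (↑Λ : Set (Site 3)) x y) = ∫ ω, g ω ∂μ := by
    rw [hg, integral_finsetSum _ fun x _ => integrable_finsetSum _ fun y _ => hint x y]
    refine Finset.sum_congr rfl fun x _ => ?_
    rw [integral_finsetSum _ fun y _ => hint x y]
    refine Finset.sum_congr rfl fun y _ => ?_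
    exact (integral_indicator_one (hAm x y)).symm
  have hDint : Integrable (fun ω => D.indicator (1 : BondConfig (Site 3) → ℝ) ω) μ :=
    (integrable_const (1 : ℝ)).indicator hDm
  have hrint : Integrable (fun ω => δ * (Λ.card : ℝ) ^ 2 +
      (Λ.card : ℝ) ^ 2 * D.indicator (1 : BondConfig (Site 3) → ℝ) ω) μ :=
    (integrable_const _).add (hDint.const_mul _)
  have hrhs : ∫ ω, (δ * (Λ.card : ℝ) ^ 2 + (Λ.card : ℝ) ^ 2 * D.indicator (1 : BondConfig (Site 3) → ℝ) ω) ∂μ =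
      δ * (Λ.card : ℝ) ^ 2 + (Λ.card : ℝ) ^ 2 * μ.real D := by
    rw [integral_add (integrable_const _) (hDint.const_mul _), integral_const, integral_const_mul,
      integral_indicator_one hDm]
    simp
  calc ∑ x ∈ Λ, ∑ y ∈ Λ, μ.real (openConnIn (↑Λ : Set (Site 3)) x y) = ∫ ω, g ω ∂μ := hlhs
    _ ≤ ∫ ω, (δ * (Λ.card : ℝ) ^ 2 + (Λ.card : ℝ) ^ 2 * D.indicator (1 : BondConfig (Site 3) → ℝ) ω) ∂μ :=
        integral_mono hgint hrint hpt
    _ = δ * (Λ.card : ℝ) ^ 2 + (Λ.card : ℝ) ^ 2 * μ.real D := hrhs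

/-- **The box sits inside the torus** (every `p`): for `2m + 2 ≤ n` and a threshold `s ≤ δ|B(m)|`,
`P_p^{ℤ³}(B(m) has a δ-dense free piece) ≤ P_p^{T_n}(∃ x, |C(x)| ≥ s)`. The torus configuration pulled
back along the local chart `w ↦ proj w` of `B(m)` has the law of the `ℤ³` configuration restricted to
`B(m)` (`integral_restrictConfig_chart_eq`), and the free piece of a box point maps injectively into the
torus cluster of its image (`ncard_reachable_restrictConfig_le`). [folklore] -/
theorem real_dense_le_torusGiant (p : unitInterval) {m n : ℕ} (hmn : 2 * m + 2 ≤ n) {δ s : ℝ}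
    (hs : s ≤ δ * ((box 3 m).card : ℝ)) :
    (bondPercolation (zdGraph 3) p).real {ω | ∃ x ∈ box 3 m,
        δ * ((box 3 m).card : ℝ) ≤
          ((((box 3 m).filter fun v => ω ∈ openConnIn (↑(box 3 m) : Set (Site 3)) x v)).card : ℝ)} ≤
      (bondPercolation (torusGraph 3 n) p).real
        {ω | ∃ x : TorusSite 3 n, s ≤ ((openCluster ω x).ncard : ℝ)} := by
  haveI : NeZero n := ⟨by omega⟩
  set μZ := bondPercolation (zdGraph 3) p with hμZ
  set μT := bondPercolation (torusGraph 3 n) p with hμT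
  set D := {ω : BondConfig (Site 3) | ∃ x ∈ box 3 m,
      δ * ((box 3 m).card : ℝ) ≤
        ((((box 3 m).filter fun v => ω ∈ openConnIn (↑(box 3 m) : Set (Site 3)) x v)).card : ℝ)} with hD
  set G := {ω : BondConfig (TorusSite 3 n) | ∃ x : TorusSite 3 n, s ≤ ((openCluster ω x).ncard : ℝ)}
    with hG
  have hDm : MeasurableSet D := measurableSet_exists_dense (box 3 m) δ
  -- the chart with base point `0`
  set f : ↥(box 3 m) → TorusSite 3 n := fun w => Torus.proj n w.1 + 0 with hfdef
  have hf : ∀ w, f w = Torus.proj n w.1 + 0 := fun w => rfl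
  -- the local functional: indicator of a dense piece of the local configuration
  set g : BondConfig ↥(box 3 m) → ℝ := fun η =>
    if ∃ a : ↥(box 3 m), δ * ((box 3 m).card : ℝ) ≤
        (Set.ncard {b : ↥(box 3 m) | (openGraph η).Reachable a b} : ℝ) then 1 else 0 with hg
  -- (i) on `ℤ³`, `g` of the box-restricted configuration is the indicator of `D`
  have hcard : ∀ (ω : BondConfig (Site 3)) (x : Site 3) (hx : x ∈ box 3 m),
      ((((box 3 m).filter fun v => ω ∈ openConnIn (↑(box 3 m) : Set (Site 3)) x v)).card : ℝ) =
        (Set.ncard {b : ↥(box 3 m) |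
          (openGraph (restrictConfig (Subtype.val : ↥(box 3 m) → Site 3) ω)).Reachable ⟨x, hx⟩ b} : ℝ) := by
    intro ω x hx
    have hset : (↑((box 3 m).filter fun v => ω ∈ openConnIn (↑(box 3 m) : Set (Site 3)) x v) : Set (Site 3)) =
        Subtype.val '' {b : ↥(box 3 m) |
          (openGraph (restrictConfig (Subtype.val : ↥(box 3 m) → Site 3) ω)).Reachable ⟨x, hx⟩ b} := by
      ext y
      simp only [Finset.coe_filter, Set.mem_setOf_eq, Set.mem_image, mem_openConnIn_iff_restrictConfig]
      constructor
      · rintro ⟨hy, _, hy', h⟩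
        exact ⟨⟨y, hy'⟩, h, rfl⟩
      · rintro ⟨⟨y, hy⟩, h, rfl⟩
        exact ⟨hy, hx, hy, h⟩
    have h := congrArg Set.ncard hset
    rw [Set.ncard_coe_finset, Set.ncard_image_of_injective _ Subtype.val_injective] at h
    exact_mod_cast h
  have hZ : ∀ ω : BondConfig (Site 3),
      g (restrictConfig (Subtype.val : ↥(box 3 m) → Site 3) ω) = D.indicator (1 : BondConfig (Site 3) → ℝ) ω := by
    intro ω
    by_cases hω : ω ∈ D
    · rw [Set.indicator_of_mem hω, Pi.one_apply]
      obtain ⟨x, hx, hle⟩ := hω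
      have hex : ∃ a : ↥(box 3 m), δ * ((box 3 m).card : ℝ) ≤
          (Set.ncard {b : ↥(box 3 m) |
            (openGraph (restrictConfig (Subtype.val : ↥(box 3 m) → Site 3) ω)).Reachable a b} : ℝ) :=
        ⟨⟨x, hx⟩, by rwa [← hcard ω x hx]⟩
      simp only [hg, if_pos hex]
    · rw [Set.indicator_of_notMem hω]
      have hnex : ¬ ∃ a : ↥(box 3 m), δ * ((box 3 m).card : ℝ) ≤
          (Set.ncard {b : ↥(box 3 m) |
            (openGraph (restrictConfig (Subtype.val : ↥(box 3 m) → Site 3) ω)).Reachable a b} : ℝ) := by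
        rintro ⟨⟨x, hx⟩, hle⟩
        exact hω ⟨x, hx, by rwa [hcard ω x hx]⟩
      simp only [hg, if_neg hnex]
  -- (ii) on the torus, `g` of the pulled-back configuration is dominated by the indicator of `G`
  have hT : ∀ ω : BondConfig (TorusSite 3 n),
      g (restrictConfig f ω) ≤ G.indicator (1 : BondConfig (TorusSite 3 n) → ℝ) ω := by
    intro ω
    by_cases h : ∃ a : ↥(box 3 m), δ * ((box 3 m).card : ℝ) ≤
        (Set.ncard {b : ↥(box 3 m) | (openGraph (restrictConfig f ω)).Reachable a b} : ℝ)
    · obtain ⟨a, ha⟩ := id h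
      have hle := ncard_reachable_restrictConfig_le (chart_injective hmn 0 f hf) ω a (Set.toFinite _)
      have hmem : ω ∈ G := ⟨f a, hs.trans (ha.trans (by exact_mod_cast hle))⟩
      rw [Set.indicator_of_mem hmem, Pi.one_apply]
      simp only [hg, if_pos h, le_refl]
    · simp only [hg, if_neg h]
      exact Set.indicator_nonneg (fun _ _ => zero_le_one) _
  -- assemble
  calc μZ.real D = ∫ ω, D.indicator (1 : BondConfig (Site 3) → ℝ) ω ∂μZ := (integral_indicator_one hDm).symm
    _ = ∫ ω, g (restrictConfig (Subtype.val : ↥(box 3 m) → Site 3) ω) ∂μZ :=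
        integral_congr_ae (Eventually.of_forall fun ω => (hZ ω).symm)
    _ = ∫ ω, g (restrictConfig f ω) ∂μT := (integral_restrictConfig_chart_eq hmn 0 f hf p g).symm
    _ ≤ ∫ ω, G.indicator (1 : BondConfig (TorusSite 3 n) → ℝ) ω ∂μT :=
        integral_mono Integrable.of_finite Integrable.of_finite hT
    _ = μT.real G := integral_indicator_one MeasurableSet.of_discrete

/-- **The torus parking edge of the crux** (`Cruxes/FreeBoxSparse/STRATEGY-CENSUS.md` §S6, §5):
`NoCriticalTorusGiant → FreeBoxSparse` — no giant on the critical 3-torus (item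
stmt-CriticalPhenomena-5407) implies that the free-box pair average at `p_c(ℤ³)` vanishes (item
stmt-CriticalPhenomena-4445). With `n = 2m + 2` and `|B(m)| = (2m+1)³ ≥ n³/8`:
`FA₂(p_c, m) ≤ δ + P_{T_n, p_c}(∃ cluster of ≥ (δ/8)·n³ vertices)` by `pairSum_le_of_dense` and
`real_dense_le_torusGiant`; the last term tends to `0`, then `δ ↓ 0`. [folklore] -/
theorem freeBoxSparse_of_noCriticalTorusGiant :
    Summit.CriticalPhenomena.PercolationContinuityZ3.Theses.PercTorusSliceFilling.NoCriticalTorusGiant →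
      Summit.CriticalPhenomena.PercolationContinuityZ3.Theses.PercNonProliferation.FreeBoxSparse := by
  intro hT
  set μ := bondPercolation (zdGraph 3) (criticalProbI 3) with hμ
  change Tendsto (fun n : ℕ => (∑ x ∈ box 3 n, ∑ y ∈ box 3 n,
      μ.real (openConnIn (↑(box 3 n) : Set (Site 3)) x y)) / (((box 3 n).card : ℝ)) ^ 2) atTop (𝓝 0)
  set F : ℕ → ℝ := fun n => (∑ x ∈ box 3 n, ∑ y ∈ box 3 n,
      μ.real (openConnIn (↑(box 3 n) : Set (Site 3)) x y)) / (((box 3 n).card : ℝ)) ^ 2 with hF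
  have hF0 : ∀ n, 0 ≤ F n := fun n =>
    div_nonneg (Finset.sum_nonneg fun x _ => Finset.sum_nonneg fun y _ => measureReal_nonneg) (sq_nonneg _)
  rw [Metric.tendsto_atTop]
  intro ε hε
  -- torus giants of density `ε/16` at size `2m + 2`
  set q : ℕ → ℝ := fun n => (bondPercolation (torusGraph 3 n) (criticalProbI 3)).real
      {ω | ∃ x : TorusSite 3 n, ε / 16 * (n : ℝ) ^ 3 ≤ ((openCluster ω x).ncard : ℝ)} with hq
  have hq0 : Tendsto q atTop (𝓝 0) := hT (ε / 16) (by positivity)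
  have hsub : Tendsto (fun m : ℕ => 2 * m + 2) atTop atTop := by
    refine tendsto_atTop_atTop.2 fun b => ⟨b, fun m hm => ?_⟩
    omega
  have hq2 : Tendsto (fun m : ℕ => q (2 * m + 2)) atTop (𝓝 0) := hq0.comp hsub
  obtain ⟨N, hN⟩ := (Metric.tendsto_atTop.1 hq2) (ε / 2) (half_pos hε)
  refine ⟨N, fun m hm => ?_⟩
  have hqm := hN m hm
  rw [Real.dist_eq, sub_zero, abs_of_nonneg measureReal_nonneg] at hqm
  rw [Real.dist_eq, sub_zero, abs_of_nonneg (hF0 m)]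
  -- the two inequalities at `δ = ε/2`
  have hcardR : ((box 3 m).card : ℝ) = (2 * (m : ℝ) + 1) ^ 3 := by
    rw [card_box]; push_cast; ring
  have hcpos : (0 : ℝ) < (box 3 m).card := by rw [hcardR]; positivity
  have h1 := pairSum_le_of_dense (criticalProbI 3) (box 3 m) (δ := ε / 2) (by positivity)
  have hs : ε / 16 * ((2 * m + 2 : ℕ) : ℝ) ^ 3 ≤ ε / 2 * ((box 3 m).card : ℝ) := by
    rw [hcardR]; push_cast
    nlinarith [sq_nonneg ((m : ℝ)), sq_nonneg ((m : ℝ) + 1), hε.le, (Nat.cast_nonneg m : (0 : ℝ) ≤ m),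
      mul_nonneg hε.le (Nat.cast_nonneg m), mul_nonneg (mul_nonneg hε.le (Nat.cast_nonneg m)) (Nat.cast_nonneg m),
      mul_nonneg (mul_nonneg (mul_nonneg hε.le (Nat.cast_nonneg m)) (Nat.cast_nonneg m)) (Nat.cast_nonneg m)]
  have h2 := real_dense_le_torusGiant (criticalProbI 3) (m := m) (n := 2 * m + 2) le_rfl hs
  -- `FA₂(m) ≤ ε/2 + q(2m+2) < ε`
  have hFle : F m ≤ ε / 2 + q (2 * m + 2) := by
    have hc2 : (0 : ℝ) < ((box 3 m).card : ℝ) ^ 2 := by positivity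
    rw [hF]
    simp only
    rw [div_le_iff₀ hc2]
    have : (ε / 2 + q (2 * m + 2)) * (((box 3 m).card : ℝ)) ^ 2 =
        ε / 2 * ((box 3 m).card : ℝ) ^ 2 + ((box 3 m).card : ℝ) ^ 2 * q (2 * m + 2) := by ring
    rw [this]
    refine h1.trans ?_
    have hmono : ((box 3 m).card : ℝ) ^ 2 * μ.real {ω | ∃ x ∈ box 3 m,
        ε / 2 * ((box 3 m).card : ℝ) ≤
          ((((box 3 m).filter fun v => ω ∈ openConnIn (↑(box 3 m) : Set (Site 3)) x v)).card : ℝ)} ≤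
        ((box 3 m).card : ℝ) ^ 2 * q (2 * m + 2) :=
      mul_le_mul_of_nonneg_left h2 hc2.le
    linarith
  linarith

/-- **`FreeBoxSparse ⟺ NoFreeGiant`**: the free-box pair average at `p_c(ℤ³)` tends to `0` iff, for every `δ > 0`,
the probability that `Λ_n = box 3 n` carries a `δ`-dense free piece (`|C_{Λ_n}(x)| ≥ δ|Λ_n|` for some `x ∈ Λ_n`)
tends to `0`. (→) Markov on the pair count (`real_exists_dense_le_pairAverage_div`); (←) off the dense event every
free piece is smaller than `δ|Λ_n|` (`pairSum_le_of_dense`), so `FA₂(n) ≤ δ + P(δ-dense piece)`. [folklore] -/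
theorem freeBoxSparse_iff_noFreeGiant :
    Summit.CriticalPhenomena.PercolationContinuityZ3.Theses.PercNonProliferation.FreeBoxSparse ↔
      ∀ δ : ℝ, 0 < δ → Tendsto (fun n : ℕ =>
        (bondPercolation (zdGraph 3) (criticalProbI 3)).real {ω | ∃ x ∈ box 3 n,
          δ * ((box 3 n).card : ℝ) ≤
            ((((box 3 n).filter fun v => ω ∈ openConnIn (↑(box 3 n) : Set (Site 3)) x v)).card : ℝ)})
        atTop (𝓝 0) := by
  set μ := bondPercolation (zdGraph 3) (criticalProbI 3) with hμ
  set F : ℕ → ℝ := fun n => (∑ x ∈ box 3 n, ∑ y ∈ box 3 n,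
      μ.real (openConnIn (↑(box 3 n) : Set (Site 3)) x y)) / (((box 3 n).card : ℝ)) ^ 2 with hF
  have hFS : Summit.CriticalPhenomena.PercolationContinuityZ3.Theses.PercNonProliferation.FreeBoxSparse ↔
      Tendsto F atTop (𝓝 0) := Iff.rfl
  have hF0 : ∀ n, 0 ≤ F n := fun n =>
    div_nonneg (Finset.sum_nonneg fun x _ => Finset.sum_nonneg fun y _ => measureReal_nonneg) (sq_nonneg _)
  rw [hFS]
  constructor
  · -- (→): `P(δ-dense piece) ≤ FA₂/δ² → 0`
    intro hS δ hδ
    have hup : ∀ n, μ.real {ω | ∃ x ∈ box 3 n, δ * ((box 3 n).card : ℝ) ≤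
        ((((box 3 n).filter fun v => ω ∈ openConnIn (↑(box 3 n) : Set (Site 3)) x v)).card : ℝ)} ≤
          F n / δ ^ 2 :=
      fun n => real_exists_dense_le_pairAverage_div (criticalProbI 3) (box_nonempty 3 n) hδ
    have hlim : Tendsto (fun n => F n / δ ^ 2) atTop (𝓝 0) := by simpa using hS.div_const (δ ^ 2)
    exact squeeze_zero (fun n => measureReal_nonneg) hup hlim
  · -- (←): `FA₂(n) ≤ δ + P(δ-dense piece)`
    intro hG
    rw [Metric.tendsto_atTop]
    intro ε hε
    obtain ⟨N, hN⟩ := (Metric.tendsto_atTop.1 (hG (ε / 2) (half_pos hε))) (ε / 2) (half_pos hε)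
    refine ⟨N, fun n hn => ?_⟩
    have hqn := hN n hn
    rw [Real.dist_eq, sub_zero, abs_of_nonneg measureReal_nonneg] at hqn
    rw [Real.dist_eq, sub_zero, abs_of_nonneg (hF0 n)]
    have hcpos : (0 : ℝ) < (box 3 n).card := by exact_mod_cast Finset.card_pos.2 (box_nonempty 3 n)
    have hc2 : (0 : ℝ) < ((box 3 n).card : ℝ) ^ 2 := by positivity
    have h1 := pairSum_le_of_dense (criticalProbI 3) (box 3 n) (δ := ε / 2) (by positivity)
    have hFle : F n ≤ ε / 2 + μ.real {ω | ∃ x ∈ box 3 n, ε / 2 * ((box 3 n).card : ℝ) ≤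
        ((((box 3 n).filter fun v => ω ∈ openConnIn (↑(box 3 n) : Set (Site 3)) x v)).card : ℝ)} := by
      rw [hF]
      simp only
      rw [div_le_iff₀ hc2]
      linarith
    linarith

end Summit.CriticalPhenomena.PercolationContinuityZ3.Theorems.FreeBoxSparse.TorusParking

end
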